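import Summits.NavierStokesRegularity.FunctionalMining.BiaxialMagicAngle
import HarnessLib

/-!
# FunctionalMining — no GLOBAL director: a smooth field on the torus cannot have `S(v)(x) c = m c` with a
# fixed vector `c ≠ 0` and a fixed `m ≠ 0` at every point; the longitudinal strain `cᵀS(v)c` has no sign

Search for candidate a priori estimates; no regularity claim. Cell `pub-nsfunc`, prove seat (gen 20).
Static calculus of smooth fields on the flat torus; nothing about Navier–Stokes dynamics.

In the zero-cost skeleton of Lemma L-λ (`SIEVELD.md` §3.4b (3), (4c), (4d) Part A) a DIRECTOR point has
`λ₂ < λ₁ = m` and a locally constant top eigenvector `e₁ ≡ c`, so `S(v) c = m c` on the director cell and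
`(c·∇)(v·c) = cᵀS(v)c = m > 0` along `c`-lines. This file records the global obstruction behind that
argument in its simplest form, as a corollary of `exists_longitudinalStrain_eq_zero_dir`
(`BiaxialMagicAngle`: for every `K` the longitudinal strain `KᵀS(v)K` vanishes somewhere):
* `not_forall_longitudinalStrain_pos` / `_neg`: `cᵀ S(v)(x) c` cannot be `> 0` (or `< 0`) at every point;
* **`no_global_director`**: if `S(v)(x) c = m·c` for all `x` with `c ≠ 0`, then `m = 0` — a director cell
  (eigenvector `c`, eigenvalue `m ≠ 0`) is never the whole torus; cell-wise versions are SIEVELD (4c)(i) /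
  (4d) Part A (pen-and-paper, not formalised).
[ours; elementary]
-/

noncomputable section

open MeasureTheory Set Filter Topology

namespace Summit.NavierStokesRegularity.FunctionalMining
open Literature.Analysis Literature.Analysis.FunctionSpaces Literature.Analysis.FunctionSpaces.Torus
  Literature.Analysis.FluidPDE

namespace BiaxialEikonal

variable {d : Type*} [Fintype d] [DecidableEq d]

/-- The longitudinal strain in a fixed direction is not everywhere positive. [ours] -/
theorem not_forall_longitudinalStrain_pos {v : UnitAddTorus d → EuclideanSpace ℝ d}
    (hv : Torus.IsSmooth v) (c : d → ℝ) :
    ¬ ∀ x, 0 < ∑ i, ∑ j, c i * c j * torusStrainMatrix v x i j := by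
  intro h
  obtain ⟨p, hp⟩ := exists_longitudinalStrain_eq_zero_dir hv c
  exact absurd (h p) (by rw [hp]; exact lt_irrefl 0)

/-- … nor everywhere negative. [ours] -/
theorem not_forall_longitudinalStrain_neg {v : UnitAddTorus d → EuclideanSpace ℝ d}
    (hv : Torus.IsSmooth v) (c : d → ℝ) :
    ¬ ∀ x, ∑ i, ∑ j, c i * c j * torusStrainMatrix v x i j < 0 := by
  intro h
  obtain ⟨p, hp⟩ := exists_longitudinalStrain_eq_zero_dir hv c
  exact absurd (h p) (by rw [hp]; exact lt_irrefl 0)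

omit [DecidableEq d] in
/-- Contracting an eigenvector equation: `S c = m c ⇒ cᵀ S c = m |c|²`. [folklore] -/
theorem longitudinal_of_eigen {S : Matrix d d ℝ} {c : d → ℝ} {m : ℝ}
    (h : ∀ i, ∑ j, S i j * c j = m * c i) :
    ∑ i, ∑ j, c i * c j * S i j = m * ∑ i, c i ^ 2 := by
  have e : ∀ i, ∑ j, c i * c j * S i j = c i * (m * c i) := fun i => by
    rw [← h i, Finset.mul_sum]
    exact Finset.sum_congr rfl fun j _ => by ring
  simp only [e, Finset.mul_sum]
  exact Finset.sum_congr rfl fun i _ => by ring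

/-- **NO GLOBAL DIRECTOR.** If a smooth field `v` on `T^d` has `S(v)(x) c = m·c` at EVERY point for a fixed
vector `c ≠ 0` and a fixed `m`, then `m = 0`: the longitudinal strain `cᵀS(v)c = m|c|²` must vanish
somewhere (`exists_longitudinalStrain_eq_zero_dir`). So a director structure `e₁ ≡ c`, `λ₁ ≡ m > 0` of the
zero-cost skeleton (SIEVELD §3.4b (3)) is never global. [ours] -/
theorem no_global_director {v : UnitAddTorus d → EuclideanSpace ℝ d} (hv : Torus.IsSmooth v)
    {c : d → ℝ} (hc : c ≠ 0) {m : ℝ}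
    (h : ∀ x i, ∑ j, torusStrainMatrix v x i j * c j = m * c i) : m = 0 := by
  obtain ⟨p, hp⟩ := exists_longitudinalStrain_eq_zero_dir hv c
  rw [longitudinal_of_eigen (h p)] at hp
  have hpos : 0 < ∑ i, c i ^ 2 := by
    obtain ⟨i, hi⟩ : ∃ i, c i ≠ 0 := by
      by_contra hall
      push Not at hall
      exact hc (funext hall)
    exact lt_of_lt_of_le (by positivity) (Finset.single_le_sum (fun j _ => sq_nonneg (c j)) (Finset.mem_univ i))
  exact (mul_eq_zero.mp hp).resolve_right (ne_of_gt hpos)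

/-- Equivalently: a non-zero eigenvalue of a fixed direction cannot persist over the whole torus. [ours] -/
theorem exists_not_eigen {v : UnitAddTorus d → EuclideanSpace ℝ d} (hv : Torus.IsSmooth v)
    {c : d → ℝ} (hc : c ≠ 0) {m : ℝ} (hm : m ≠ 0) :
    ∃ x i, ∑ j, torusStrainMatrix v x i j * c j ≠ m * c i := by
  by_contra h
  push Not at h
  exact hm (no_global_director hv hc h)

end BiaxialEikonal

end Summit.NavierStokesRegularity.FunctionalMining

end
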